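import Summits.BirchSwinnertonDyer.Rank1Residual.Additive.QuadraticBranchPlusEtaNodes
import Summits.BirchSwinnertonDyer.Rank1Residual.Additive.QuadraticBranchPlusLFunctionUnique
import Literature.NumberTheory.EllipticCurves.BurungaleTian2026.EtaSignedMainConjectureTensorQ
import Literature.NumberTheory.EllipticCurves.IwasawaSelmerIsTorsionProofs
import HarnessLib

/-!
# Route `QuadraticBranchSignedControl` (rung K8, cell `bsd-potss`), node (C1⁺_η) on the CM rows — item
# stmt-BirchSwinnertonDyer-19114 `PlusMainConjectureBranch` (CM twists) / residual crux 19606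
# `PlusEtaMainConjectureNonsurj` (registered stub `stub_etaMC_cm`): Kobayashi's EVEN main conjecture at
# `η` for a CM twist holds UP TO POWERS OF `p` by Burungale–Tian 2026 (Annals) Thm. 2.6, and IN FULL it
# IS the `μ`-equality — transported to the route's `η`-node currency (seat `bsd-potss-k8q-c2` g3)

WHAT. Cell `bsd-cm` (seat `bsd-cm-k8i-ty` g6) landed the NAMED Literature fact
`BurungaleTian2026.thm26_etaKatoSequences_charIdeal_upToP_of_cm` — Burungale–Tian, Ann. of Math. 203
(2026), **Thm. 2.6** (Kato's main conjecture in `Λ ⊗ ℚ` for EVERY CM newform and every `p`) composed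
with Kobayashi 2003 §5 / Prop. 7.1 ii) / the two `η`-sequences of the proof of Thm. 7.4 — and its kernel
consequences on the Literature copy of the `η`-object: `evenEtaCharIdeal_eq_upToP_of_cm_of_unique`
(CM `V`, odd good `p`, `a_p = 0`: `(p^b)·Char(X⁺(V/K_∞)^η) = (p^a)·(L_p⁺(V, η, X))`) and the
`μ`-criterion `evenEtaCharIdeal_eq_iff_muInvariant_eq_of_cm`. THIS FILE transports them to THIS route's
currency — the typed `η`-node `Additive.QuadraticBranchPlusEtaMainConjectureAt V p` (k8q-c2 g2, p427065;
= the conclusion of 19606's registered stub `stub_etaMC_cm`; through the landed `η`-seams, the CM rows of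
item 19114) — via the `rfl` bridge `EtaSignedSelmerDualData.toLiterature` and the choice-freeness of
`(L_p⁺(V, η, X))` (`Additive.IsQuadraticBranchPlusLFunction.span_singleton_eq` discharges the fact's
displayed uniqueness hypothesis `huniq`):
* §0 `Λ`-algebra of «equal up to powers of `p`»: from `(p^b)·I = (p^a)·(L)`, `(L) ⊆ I` when `a ≤ b`
  and `I ⊆ (L)` when `b ≤ a`; for `I = Char(X)` the exponents compare as the `μ`-invariants do.
* §1 per CM pair and `η`-datum: `charIdeal_upToP_of_cm`, `charIdeal_eq_iff_muInvariant_eq_of_cm`.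
* §2 node level on the CM rows: (C1⁺_η)(V,p) ⟺ the `μ`-equality; the EISENSTEIN inclusion (E⁺_η)(V,p)
  from `μ(Λ/(L_η)) ≤ μ(X⁺^η)` — in particular from `μ(L_p⁺(V, η, X)) = 0` ALONE; the INTEGRAL
  Kato-side inclusion `(L_η) ⊆ Char(X⁺^η)` (text of the skeleton's `EtaUpperIntegralAt V p` =
  `stub_etaMC_cm_upper` at the pair) from `μ(X⁺^η) ≤ μ(Λ/(L_η))`.
* §3 the ∀-form on 19606's binders: `stub_etaMC_cm`'s text ⟸ the two named facts + the `μ`-equality.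

EFFECT ON THE RECORD (honest). Before this fact the CM rows of (C1_η) were «a REMARK in print»
(Pollack–Rubin 2004 p. 448; FIND-19114-k8q-c2). They are now «a THEOREM in print UP TO `μ`» (Annals
2026); what is left on the CM rows is EXACTLY the `μ`-part (Burungale–Tian's own Rem. 2.7). The
analytic-rank-`0` CM rows are settled outright from named facts in the companion file
`…PlusEtaCMRankZeroOfBT26` (the constant-term squeeze pins `a = b`).

HONEST FRAMING (cell `bsd-potss`, run/shared/lean/pub/bsd-potss/; FULL-BSD rank ≤ 1 programme, tranche
1b, HUMAN RULING D-0036/D-0074): THEOREMS ONLY — no definition, no new named fact, no Summits-side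
`def … : Prop`, no `sorry`, axioms standard. Every statement is CONDITIONAL on named facts in hypothesis
position — `BurungaleTian2026.thm26_etaKatoSequences_charIdeal_upToP_of_cm` (NOT proved in the tree),
Kobayashi 2003 Thm. 2.2 at `η` (`thm22_etaSignedSelmerDual_finite_torsion`) — and, where stated, on the
displayed `μ`-(in)equalities (OPEN). Item 19114, crux 19606 and `stub_etaMC_cm` stay OPEN; nothing is
booked; no label / mark / count of `RESIDUAL-MAP.md` moves; BSD is not proved for any curve by this.
`--supports stmt-BirchSwinnertonDyer-19606` (bears on 19114's CM rows through the landed `η`-seams).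

References: [BurungaleTian2026] Thm. 2.6 and Rem. 2.7 (p. 5); [Kobayashi2003] §4 Even main conjecture
(p. 8), Thm. 2.2 (p. 5), §5 and Prop. 7.1 ii) (pp. 8–12), proof of Thm. 7.4 (p. 13), Thm. 3.2 with
(3.4)/(3.6) (p. 7); [PollackRubin2004] Theorem and remark p. 448; [Washington1997] §13.2.
-/

set_option autoImplicit false
set_option linter.dupNamespace false

noncomputable section

open scoped Classical

open CongruenceSubgroup WeierstrassCurve Field Literature.NumberTheory.EllipticCurves
  Literature.NumberTheory.EllipticCurves.ModularForms Literature.NumberTheory.GaloisRepresentations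
  ZpExtension
open Literature.NumberTheory.EllipticCurves.IwasawaAlgebra
open Literature.NumberTheory.EllipticCurves.IwasawaDual
open Summit.BirchSwinnertonDyer.Rank1Residual.Additive

namespace Summit.BirchSwinnertonDyer.BirchSwinnertonDyer.Theorems

namespace EtaCMUpToMu
/-! ## §0 `Λ`-algebra: ideals equal up to powers of `p` -/

section Algebra

variable {p : ℕ} [hp : Fact p.Prime]

/-- `p^a ≠ 0` in `Λ = ℤ_p⟦X⟧`. [folklore] -/
theorem natCast_pow_ne_zero (a : ℕ) : ((p : IwasawaAlgebra p) ^ a) ≠ 0 := by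
  rw [← map_natCast (PowerSeries.C (R := ℤ_[p])) p]
  exact pow_ne_zero _ (prime_C p).ne_zero

/-- **`(p^b)·I = (p^a)·(L)` with `a ≤ b` gives `(L) ⊆ I`** (cancel `(p^a)`: `(p^{b−a})·I = (L)`).
[cite: Washington1997, §13.2] -/
theorem span_le_of_upToP_of_le {I : Ideal (IwasawaAlgebra p)} {L : IwasawaAlgebra p} {a b : ℕ}
    (hab : Ideal.span {(p : IwasawaAlgebra p) ^ b} * I =
      Ideal.span {(p : IwasawaAlgebra p) ^ a} * Ideal.span {L})
    (h : a ≤ b) : Ideal.span {L} ≤ I := by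
  obtain ⟨c, rfl⟩ := Nat.exists_eq_add_of_le h
  rw [pow_add, ← Ideal.span_singleton_mul_span_singleton, mul_assoc,
    Ideal.span_singleton_mul_right_inj (natCast_pow_ne_zero a)] at hab
  rw [← hab]
  exact Ideal.mul_le_left

/-- **`(p^b)·I = (p^a)·(L)` with `b ≤ a` gives `I ⊆ (L)`** (cancel `(p^b)`: `I = (p^{a−b})·(L)`).
[cite: Washington1997, §13.2] -/
theorem le_span_of_upToP_of_le {I : Ideal (IwasawaAlgebra p)} {L : IwasawaAlgebra p} {a b : ℕ}
    (hab : Ideal.span {(p : IwasawaAlgebra p) ^ b} * I =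
      Ideal.span {(p : IwasawaAlgebra p) ^ a} * Ideal.span {L})
    (h : b ≤ a) : I ≤ Ideal.span {L} := by
  obtain ⟨c, rfl⟩ := Nat.exists_eq_add_of_le h
  rw [pow_add, ← Ideal.span_singleton_mul_span_singleton, mul_assoc,
    Ideal.span_singleton_mul_right_inj (natCast_pow_ne_zero b)] at hab
  rw [hab]
  exact Ideal.mul_le_left

/-- If `(p^b)·Char(X) = (p^a)·(L)` then `L ≠ 0` (characteristic ideals over `Λ` are non-zero
principal). [cite: Washington1997, §13.2] -/
theorem ne_zero_of_upToP (X : Type) [AddCommGroup X] [Module (IwasawaAlgebra p) X]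
    {L : IwasawaAlgebra p} {a b : ℕ}
    (hab : Ideal.span {(p : IwasawaAlgebra p) ^ b} * Module.charIdeal (IwasawaAlgebra p) X =
      Ideal.span {(p : IwasawaAlgebra p) ^ a} * Ideal.span {L}) : L ≠ 0 := by
  intro hL
  obtain ⟨g, hg0, hg⟩ := BurungaleTian2026.exists_charIdeal_eq_span_ne_zero (p := p) X
  have h1 : Ideal.span {(p : IwasawaAlgebra p) ^ b * g} = ⊥ := by
    rw [← Ideal.span_singleton_mul_span_singleton, ← hg, hab, hL, Ideal.span_singleton_mul_span_singleton,
      mul_zero, Ideal.span_singleton_eq_bot]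
  exact mul_ne_zero (natCast_pow_ne_zero b) hg0 (Ideal.span_singleton_eq_bot.mp h1)

/-- **The exponents compare as the `μ`-invariants do.** For `X` finitely generated torsion with
`(p^b)·Char(X) = (p^a)·(L)`: `b + μ(X) = a + μ(Λ/(L))` (`μ` is read off the characteristic ideal;
`μ(Λ/(p^k·x)) = k + μ(Λ/(x))` — both from the BT26 file). [cite: Washington1997, §13.2] -/
theorem add_muInvariant_eq_of_upToP (X : Type) [AddCommGroup X] [Module (IwasawaAlgebra p) X]
    [Module.Finite (IwasawaAlgebra p) X] (hX : Module.IsTorsion (IwasawaAlgebra p) X)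
    {L : IwasawaAlgebra p} {a b : ℕ}
    (hab : Ideal.span {(p : IwasawaAlgebra p) ^ b} * Module.charIdeal (IwasawaAlgebra p) X =
      Ideal.span {(p : IwasawaAlgebra p) ^ a} * Ideal.span {L}) :
    b + muInvariant p X = a + muInvariant p (IwasawaAlgebra p ⧸ Ideal.span {L}) := by
  have hL : L ≠ 0 := ne_zero_of_upToP X hab
  obtain ⟨g, hg0, hg⟩ := BurungaleTian2026.exists_charIdeal_eq_span_ne_zero (p := p) X
  have hμg : muInvariant p X = muInvariant p (IwasawaAlgebra p ⧸ Ideal.span {g}) :=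
    BurungaleTian2026.muInvariant_eq_muInvariant_quotient_of_charIdeal_eq_span X hX hg
  have hideal : Ideal.span {(p : IwasawaAlgebra p) ^ b * g} =
      Ideal.span {(p : IwasawaAlgebra p) ^ a * L} := by
    rw [← Ideal.span_singleton_mul_span_singleton, ← Ideal.span_singleton_mul_span_singleton, ← hg, hab]
  have hμ2 : muInvariant p (IwasawaAlgebra p ⧸ Ideal.span {(p : IwasawaAlgebra p) ^ b * g}) =
      muInvariant p (IwasawaAlgebra p ⧸ Ideal.span {(p : IwasawaAlgebra p) ^ a * L}) :=
    muInvariant_eq_of_linearEquiv (Submodule.quotEquivOfEq _ _ hideal)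
  rw [BurungaleTian2026.muInvariant_quotient_pow_mul hg0, BurungaleTian2026.muInvariant_quotient_pow_mul hL,
    ← hμg] at hμ2
  exact hμ2

/-- **`(L) ⊆ Char(X)` from `μ(X) ≤ μ(Λ/(L))`** when `(p^b)·Char(X) = (p^a)·(L)` (`X` finitely
generated torsion): the Kato-side ("upper") inclusion is controlled by `μ` alone.
[cite: Washington1997, §13.2] -/
theorem span_le_charIdeal_of_upToP_of_muInvariant_le (X : Type) [AddCommGroup X]
    [Module (IwasawaAlgebra p) X] [Module.Finite (IwasawaAlgebra p) X]
    (hX : Module.IsTorsion (IwasawaAlgebra p) X) {L : IwasawaAlgebra p} {a b : ℕ}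
    (hab : Ideal.span {(p : IwasawaAlgebra p) ^ b} * Module.charIdeal (IwasawaAlgebra p) X =
      Ideal.span {(p : IwasawaAlgebra p) ^ a} * Ideal.span {L})
    (hμ : muInvariant p X ≤ muInvariant p (IwasawaAlgebra p ⧸ Ideal.span {L})) :
    Ideal.span {L} ≤ Module.charIdeal (IwasawaAlgebra p) X := by
  have h := add_muInvariant_eq_of_upToP X hX hab
  exact span_le_of_upToP_of_le hab (by omega)

/-- **`Char(X) ⊆ (L)` from `μ(Λ/(L)) ≤ μ(X)`** when `(p^b)·Char(X) = (p^a)·(L)` (`X` finitely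
generated torsion): the Eisenstein ("lower") inclusion is controlled by `μ` alone.
[cite: Washington1997, §13.2] -/
theorem charIdeal_le_span_of_upToP_of_le_muInvariant (X : Type) [AddCommGroup X]
    [Module (IwasawaAlgebra p) X] [Module.Finite (IwasawaAlgebra p) X]
    (hX : Module.IsTorsion (IwasawaAlgebra p) X) {L : IwasawaAlgebra p} {a b : ℕ}
    (hab : Ideal.span {(p : IwasawaAlgebra p) ^ b} * Module.charIdeal (IwasawaAlgebra p) X =
      Ideal.span {(p : IwasawaAlgebra p) ^ a} * Ideal.span {L})
    (hμ : muInvariant p (IwasawaAlgebra p ⧸ Ideal.span {L}) ≤ muInvariant p X) :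
    Module.charIdeal (IwasawaAlgebra p) X ≤ Ideal.span {L} := by
  have h := add_muInvariant_eq_of_upToP X hX hab
  exact le_span_of_upToP_of_le hab (by omega)

end Algebra

/-! ## §1 Per CM pair, per `η`-datum: Burungale–Tian on the route's `η`-data -/

section PerPair

variable {p : ℕ} [hp : Fact p.Prime] {V : WeierstrassCurve ℚ} [V.IsElliptic] [V.IsGloballyMinimal]

/-- **Kobayashi's even main conjecture at `η` for a CM twist, UP TO POWERS OF `p`, on the route's
`η`-data.** For `V/ℚ` CM, globally minimal, good at the odd `p` with `a_p(V) = 0`, on the binders of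
the node `QuadraticBranchPlusEtaMainConjectureAt V p` and for EVERY `η`-datum `D`:
`(p^b)·Char(D.X) = (p^a)·(Lη)` for some `a b : ℕ` — named facts `h26` (BT26 Thm. 2.6 ∘ Kob03) + `h22`
(Kob03 Thm. 2.2 at `η`) through the `rfl` bridge `D.toLiterature`; the fact's displayed uniqueness
`huniq` is DISCHARGED by `IsQuadraticBranchPlusLFunction.span_singleton_eq`. CONDITIONAL; nothing booked.
[cite: BurungaleTian2026, Thm. 2.6 (p. 5)] [cite: Kobayashi2003, proof of Thm. 7.4 (p. 13), Prop. 7.1 ii) (p. 12), Thm. 2.2 (p. 5), Thm. 3.2 (p. 7)] -/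
theorem charIdeal_upToP_of_cm
    (h26 : BurungaleTian2026.thm26_etaKatoSequences_charIdeal_upToP_of_cm)
    (h22 : Kobayashi2003.thm22_etaSignedSelmerDual_finite_torsion) (hCM : V.HasCM)
    {K₀ : Type} [Field K₀] [NumberField K₀] [IsCyclotomicExtension {p} ℚ K₀]
    [(galRange (K := ℚ) K₀).Normal] {ηq : absoluteGaloisGroup ℚ →* ℤˣ}
    (hηK : ∀ σ ∈ galRange (K := ℚ) K₀, ηq σ = 1) (hη1 : ηq ≠ 1)
    {N : ℕ} [NeZero N] {f : CuspForm (Gamma0 N) 2}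
    (hp2 : p ≠ 2) (hgood : V.HasGoodReductionAtPrime p) (hap : V.frobeniusTrace p = 0)
    (hf : IsNewformOf V f) (ϖ : ℚ)
    (hϖ : if Even (p / 2) then (ϖ : ℝ) * V.realPeriodRat = plusPeriod f
      else (ϖ : ℝ) * V.imaginaryPeriodRat = minusPeriod f)
    (Lη : IwasawaAlgebra p) (hL : IsQuadraticBranchPlusLFunction f p ϖ Lη)
    {κ : ZpExtension ℚ p} {γ : absoluteGaloisGroup ℚ} (hκ : κ.IsCyclotomic)
    (hγ : κ.IsTopGenerator γ) (hγK : γ ∈ galRange (K := ℚ) K₀) (hγc : IsCyclotomicVariable p γ)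
    (D : EtaSignedSelmerDualData V κ K₀ ℚ_[p] ηq γ 1) :
    ∃ a b : ℕ, Ideal.span {(p : IwasawaAlgebra p) ^ b} * D.charIdeal =
      Ideal.span {(p : IwasawaAlgebra p) ^ a} * Ideal.span {Lη} :=
  BurungaleTian2026.evenEtaCharIdeal_eq_upToP_of_cm_of_unique h26 h22 K₀ ηq hηK hη1 V hp2 hCM hgood hap
    hf ϖ hϖ (fun _ _ h₁ h₂ => IsQuadraticBranchPlusLFunction.span_singleton_eq (f := f) hp2 h₁ h₂)
    κ γ hκ hγ hγK hγc Lη hL D.toLiterature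

/-- **The `μ`-criterion on the route's `η`-data.** Same frame: for a CM `V`, every `Lη` with the
interpolation property and every `η`-datum `D`, Kobayashi's even main conjecture at `η` for `D` —
`Char(D.X) = (Lη)` — holds IF AND ONLY IF `μ(D.X) = μ(Λ/(Lη))`. The distinguished-polynomial part is
print (BT26 Thm. 2.6); the `μ`-part is BT26 Rem. 2.7. CONDITIONAL on `h26`, `h22`; nothing booked.
[cite: BurungaleTian2026, Thm. 2.6 and Rem. 2.7 (p. 5)] [cite: Kobayashi2003, §4 Even main conjecture (p. 8), Thm. 2.2 (p. 5)]
[cite: Washington1997, §13.2] -/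
theorem charIdeal_eq_iff_muInvariant_eq_of_cm
    (h26 : BurungaleTian2026.thm26_etaKatoSequences_charIdeal_upToP_of_cm)
    (h22 : Kobayashi2003.thm22_etaSignedSelmerDual_finite_torsion) (hCM : V.HasCM)
    {K₀ : Type} [Field K₀] [NumberField K₀] [IsCyclotomicExtension {p} ℚ K₀]
    [(galRange (K := ℚ) K₀).Normal] {ηq : absoluteGaloisGroup ℚ →* ℤˣ}
    (hηK : ∀ σ ∈ galRange (K := ℚ) K₀, ηq σ = 1) (hη1 : ηq ≠ 1)
    {N : ℕ} [NeZero N] {f : CuspForm (Gamma0 N) 2}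
    (hp2 : p ≠ 2) (hgood : V.HasGoodReductionAtPrime p) (hap : V.frobeniusTrace p = 0)
    (hf : IsNewformOf V f) (ϖ : ℚ)
    (hϖ : if Even (p / 2) then (ϖ : ℝ) * V.realPeriodRat = plusPeriod f
      else (ϖ : ℝ) * V.imaginaryPeriodRat = minusPeriod f)
    (Lη : IwasawaAlgebra p) (hL : IsQuadraticBranchPlusLFunction f p ϖ Lη)
    {κ : ZpExtension ℚ p} {γ : absoluteGaloisGroup ℚ} (hκ : κ.IsCyclotomic)
    (hγ : κ.IsTopGenerator γ) (hγK : γ ∈ galRange (K := ℚ) K₀) (hγc : IsCyclotomicVariable p γ)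
    (D : EtaSignedSelmerDualData V κ K₀ ℚ_[p] ηq γ 1) :
    D.charIdeal = Ideal.span {Lη} ↔
      muInvariant p D.X = muInvariant p (IwasawaAlgebra p ⧸ Ideal.span {Lη}) :=
  BurungaleTian2026.evenEtaCharIdeal_eq_iff_muInvariant_eq_of_cm h26 h22 K₀ ηq hηK hη1 V hp2 hCM hgood
    hap hf ϖ hϖ (fun _ _ h₁ h₂ => IsQuadraticBranchPlusLFunction.span_singleton_eq (f := f) hp2 h₁ h₂)
    κ γ hκ hγ hγK hγc Lη hL D.toLiterature

end PerPair

/-! ## §2 Node level on the CM rows: (C1⁺_η) is the `μ`-equality; each half is a `μ`-inequality -/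

section Node

variable {p : ℕ} [hp : Fact p.Prime] {V : WeierstrassCurve ℚ} [V.IsElliptic] [V.IsGloballyMinimal]

/-- **(C1⁺_η)(V,p) for a CM twist ⟺ the `μ`-equality on every `η`-datum.** Granted the named facts
`h26` (BT26 Thm. 2.6 ∘ Kob03) and `h22` (Kob03 Thm. 2.2 at `η`), the node
`QuadraticBranchPlusEtaMainConjectureAt V p` for a CM `V` holds IF AND ONLY IF, on the node's own
binders, `μ(D.X) = μ(Λ/(Lη))` for every `Lη` with the interpolation property and every `η`-datum `D`.
So on the CM rows of crux 19606 / item 19114 the open content is EXACTLY the `μ`-part.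
CONDITIONAL; nothing booked. [cite: BurungaleTian2026, Thm. 2.6 and Rem. 2.7 (p. 5)]
[cite: Kobayashi2003, §4 Even main conjecture (p. 8), Thm. 2.2 (p. 5)] -/
theorem quadraticBranchPlusEtaMainConjectureAt_iff_muInvariant_eq_of_cm
    (h26 : BurungaleTian2026.thm26_etaKatoSequences_charIdeal_upToP_of_cm)
    (h22 : Kobayashi2003.thm22_etaSignedSelmerDual_finite_torsion) (hCM : V.HasCM) :
    QuadraticBranchPlusEtaMainConjectureAt V p ↔
      ∀ (K₀ : Type) [Field K₀] [NumberField K₀] [IsCyclotomicExtension {p} ℚ K₀]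
          [(galRange (K := ℚ) K₀).Normal] (ηq : absoluteGaloisGroup ℚ →* ℤˣ),
          (∀ σ ∈ galRange (K := ℚ) K₀, ηq σ = 1) → ηq ≠ 1 →
        ∀ {N : ℕ} [NeZero N] {f : CuspForm (Gamma0 N) 2},
          p ≠ 2 → V.HasGoodReductionAtPrime p → V.frobeniusTrace p = 0 → IsNewformOf V f →
        ∀ (ϖ : ℚ), (if Even (p / 2) then (ϖ : ℝ) * V.realPeriodRat = plusPeriod f
            else (ϖ : ℝ) * V.imaginaryPeriodRat = minusPeriod f) →
        ∀ (Lη : IwasawaAlgebra p), IsQuadraticBranchPlusLFunction f p ϖ Lη →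
        ∀ (κ : ZpExtension ℚ p) (γ : absoluteGaloisGroup ℚ),
          κ.IsCyclotomic → κ.IsTopGenerator γ → γ ∈ galRange (K := ℚ) K₀ → IsCyclotomicVariable p γ →
        ∀ (D : EtaSignedSelmerDualData V κ K₀ ℚ_[p] ηq γ 1),
          muInvariant p D.X = muInvariant p (IwasawaAlgebra p ⧸ Ideal.span {Lη}) := by
  constructor
  · intro h K₀ _ _ _ _ ηq hηK hη1 N _ f hp2 hgood hap hf ϖ hϖ Lη hL κ γ hκ hγ hγK hγc D
    exact (charIdeal_eq_iff_muInvariant_eq_of_cm h26 h22 hCM hηK hη1 hp2 hgood hap hf ϖ hϖ Lη hL hκ hγ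
      hγK hγc D).mp (h K₀ ηq hηK hη1 hp2 hgood hap hf ϖ hϖ Lη hL κ γ hκ hγ hγK hγc D).2.2
  · intro hμ K₀ _ _ _ _ ηq hηK hη1 N _ f hp2 hgood hap hf ϖ hϖ Lη hL κ γ hκ hγ hγK hγc D
    obtain ⟨hfin, htor⟩ :=
      EtaSignedSelmerDualData.finite_isTorsion_of_thm22 h22 hηK hp2 hgood hap hκ hγ hγK D
    exact ⟨hfin, htor, (charIdeal_eq_iff_muInvariant_eq_of_cm h26 h22 hCM hηK hη1 hp2 hgood hap hf ϖ hϖ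
      Lη hL hκ hγ hγK hγc D).mpr (hμ K₀ ηq hηK hη1 hp2 hgood hap hf ϖ hϖ Lη hL κ γ hκ hγ hγK hγc D)⟩

/-- **The Eisenstein inclusion (E⁺_η)(V,p) on a CM twist from the `μ`-inequality
`μ(Λ/(Lη)) ≤ μ(X⁺(V/K_∞)^η)`** (node `QuadraticBranchPlusEtaLowerInclusionAt V p`; the inequality
displayed on the node's binders). Granted `h26`, `h22`. CONDITIONAL; nothing booked.
[cite: BurungaleTian2026, Thm. 2.6 (p. 5)] [cite: Kobayashi2003, §4 Even main conjecture (p. 8), Thm. 2.2 (p. 5)] -/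
theorem quadraticBranchPlusEtaLowerInclusionAt_of_cm_of_le_muInvariant
    (h26 : BurungaleTian2026.thm26_etaKatoSequences_charIdeal_upToP_of_cm)
    (h22 : Kobayashi2003.thm22_etaSignedSelmerDual_finite_torsion) (hCM : V.HasCM)
    (hμ : ∀ (K₀ : Type) [Field K₀] [NumberField K₀] [IsCyclotomicExtension {p} ℚ K₀]
        [(galRange (K := ℚ) K₀).Normal] (ηq : absoluteGaloisGroup ℚ →* ℤˣ),
        (∀ σ ∈ galRange (K := ℚ) K₀, ηq σ = 1) → ηq ≠ 1 →
      ∀ {N : ℕ} [NeZero N] {f : CuspForm (Gamma0 N) 2},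
        p ≠ 2 → V.HasGoodReductionAtPrime p → V.frobeniusTrace p = 0 → IsNewformOf V f →
      ∀ (ϖ : ℚ), (if Even (p / 2) then (ϖ : ℝ) * V.realPeriodRat = plusPeriod f
          else (ϖ : ℝ) * V.imaginaryPeriodRat = minusPeriod f) →
      ∀ (Lη : IwasawaAlgebra p), IsQuadraticBranchPlusLFunction f p ϖ Lη →
      ∀ (κ : ZpExtension ℚ p) (γ : absoluteGaloisGroup ℚ),
        κ.IsCyclotomic → κ.IsTopGenerator γ → γ ∈ galRange (K := ℚ) K₀ → IsCyclotomicVariable p γ →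
      ∀ (D : EtaSignedSelmerDualData V κ K₀ ℚ_[p] ηq γ 1),
        muInvariant p (IwasawaAlgebra p ⧸ Ideal.span {Lη}) ≤ muInvariant p D.X) :
    QuadraticBranchPlusEtaLowerInclusionAt V p := by
  intro K₀ _ _ _ _ ηq hηK hη1 N _ f hp2 hgood hap hf ϖ hϖ Lη hL κ γ hκ hγ hγK hγc D
  obtain ⟨hfin, htor⟩ :=
    EtaSignedSelmerDualData.finite_isTorsion_of_thm22 h22 hηK hp2 hgood hap hκ hγ hγK D
  obtain ⟨a, b, hab⟩ := charIdeal_upToP_of_cm h26 h22 hCM hηK hη1 hp2 hgood hap hf ϖ hϖ Lη hL hκ hγ hγK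
    hγc D
  haveI := hfin
  exact charIdeal_le_span_of_upToP_of_le_muInvariant D.X htor hab
    (hμ K₀ ηq hηK hη1 hp2 hgood hap hf ϖ hϖ Lη hL κ γ hκ hγ hγK hγc D)

/-- **(E⁺_η)(V,p) on a CM twist from `μ(L_p⁺(V, η, X)) = 0` ALONE** (`μ(Λ/(Lη)) = 0` for every `Lη`
with the interpolation property — a unit coefficient; choice-free): granted `h26`, `h22`, the Eisenstein
half on the CM rows needs NO algebraic input beyond print once the analytic `μ` vanishes. CONDITIONAL.
[cite: BurungaleTian2026, Thm. 2.6 (p. 5)] [cite: Kobayashi2003, §4 (p. 8), Thm. 3.2 (p. 7)] -/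
theorem quadraticBranchPlusEtaLowerInclusionAt_of_cm_of_analyticMu_eq_zero
    (h26 : BurungaleTian2026.thm26_etaKatoSequences_charIdeal_upToP_of_cm)
    (h22 : Kobayashi2003.thm22_etaSignedSelmerDual_finite_torsion) (hCM : V.HasCM)
    (hμ : ∀ {N : ℕ} [NeZero N] {f : CuspForm (Gamma0 N) 2}, IsNewformOf V f →
      ∀ (ϖ : ℚ), (if Even (p / 2) then (ϖ : ℝ) * V.realPeriodRat = plusPeriod f
          else (ϖ : ℝ) * V.imaginaryPeriodRat = minusPeriod f) →
      ∀ (Lη : IwasawaAlgebra p), IsQuadraticBranchPlusLFunction f p ϖ Lη →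
        muInvariant p (IwasawaAlgebra p ⧸ Ideal.span {Lη}) = 0) :
    QuadraticBranchPlusEtaLowerInclusionAt V p :=
  quadraticBranchPlusEtaLowerInclusionAt_of_cm_of_le_muInvariant h26 h22 hCM
    fun _ _ _ _ _ _ _ _ _ _ _ _ _ _ hf ϖ hϖ Lη hL _ _ _ _ _ _ _ ↦ by
      rw [hμ hf ϖ hϖ Lη hL]
      exact Nat.zero_le _

/-- **The INTEGRAL Kato-side inclusion at `η` on a CM twist — `(Lη) ⊆ Char(X⁺(V/K_∞)^η)` for every
datum, the text of 19606's skeleton abbreviation `EtaUpperIntegralAt V p` (= `stub_etaMC_cm_upper` at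
the pair) — from `μ(X⁺^η) ≤ μ(Λ/(Lη))`** (Kobayashi's Thm. 4.1 gives it only up to `pⁿ` off the
tower-onto locus; BT26 reduces the integrality to `μ`). Granted `h26`, `h22`. CONDITIONAL.
[cite: BurungaleTian2026, Thm. 2.6 (p. 5)] [cite: Kobayashi2003, Thm. 4.1 (p. 8), Thm. 2.2 (p. 5)] -/
theorem etaUpperIntegral_of_cm_of_muInvariant_le
    (h26 : BurungaleTian2026.thm26_etaKatoSequences_charIdeal_upToP_of_cm)
    (h22 : Kobayashi2003.thm22_etaSignedSelmerDual_finite_torsion) (hCM : V.HasCM)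
    (hμ : ∀ (K₀ : Type) [Field K₀] [NumberField K₀] [IsCyclotomicExtension {p} ℚ K₀]
        [(galRange (K := ℚ) K₀).Normal] (ηq : absoluteGaloisGroup ℚ →* ℤˣ),
        (∀ σ ∈ galRange (K := ℚ) K₀, ηq σ = 1) → ηq ≠ 1 →
      ∀ {N : ℕ} [NeZero N] {f : CuspForm (Gamma0 N) 2},
        p ≠ 2 → V.HasGoodReductionAtPrime p → V.frobeniusTrace p = 0 → IsNewformOf V f →
      ∀ (ϖ : ℚ), (if Even (p / 2) then (ϖ : ℝ) * V.realPeriodRat = plusPeriod f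
          else (ϖ : ℝ) * V.imaginaryPeriodRat = minusPeriod f) →
      ∀ (Lη : IwasawaAlgebra p), IsQuadraticBranchPlusLFunction f p ϖ Lη →
      ∀ (κ : ZpExtension ℚ p) (γ : absoluteGaloisGroup ℚ),
        κ.IsCyclotomic → κ.IsTopGenerator γ → γ ∈ galRange (K := ℚ) K₀ → IsCyclotomicVariable p γ →
      ∀ (D : EtaSignedSelmerDualData V κ K₀ ℚ_[p] ηq γ 1),
        muInvariant p D.X ≤ muInvariant p (IwasawaAlgebra p ⧸ Ideal.span {Lη})) :
    ∀ (K₀ : Type) [Field K₀] [NumberField K₀] [IsCyclotomicExtension {p} ℚ K₀]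
        [(galRange (K := ℚ) K₀).Normal] (ηq : absoluteGaloisGroup ℚ →* ℤˣ),
        (∀ σ ∈ galRange (K := ℚ) K₀, ηq σ = 1) → ηq ≠ 1 →
      ∀ {N : ℕ} [NeZero N] {f : CuspForm (Gamma0 N) 2},
        p ≠ 2 → V.HasGoodReductionAtPrime p → V.frobeniusTrace p = 0 → IsNewformOf V f →
      ∀ (ϖ : ℚ), (if Even (p / 2) then (ϖ : ℝ) * V.realPeriodRat = plusPeriod f
          else (ϖ : ℝ) * V.imaginaryPeriodRat = minusPeriod f) →
      ∀ (Lη : IwasawaAlgebra p), IsQuadraticBranchPlusLFunction f p ϖ Lη →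
      ∀ (κ : ZpExtension ℚ p) (γ : absoluteGaloisGroup ℚ),
        κ.IsCyclotomic → κ.IsTopGenerator γ → γ ∈ galRange (K := ℚ) K₀ → IsCyclotomicVariable p γ →
      ∀ (D : EtaSignedSelmerDualData V κ K₀ ℚ_[p] ηq γ 1), Ideal.span {Lη} ≤ D.charIdeal := by
  intro K₀ _ _ _ _ ηq hηK hη1 N _ f hp2 hgood hap hf ϖ hϖ Lη hL κ γ hκ hγ hγK hγc D
  obtain ⟨hfin, htor⟩ :=
    EtaSignedSelmerDualData.finite_isTorsion_of_thm22 h22 hηK hp2 hgood hap hκ hγ hγK D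
  obtain ⟨a, b, hab⟩ := charIdeal_upToP_of_cm h26 h22 hCM hηK hη1 hp2 hgood hap hf ϖ hϖ Lη hL hκ hγ hγK
    hγc D
  haveI := hfin
  exact span_le_charIdeal_of_upToP_of_muInvariant_le D.X htor hab
    (hμ K₀ ηq hηK hη1 hp2 hgood hap hf ϖ hϖ Lη hL κ γ hκ hγ hγK hγc D)

end Node

/-! ## §3 The ∀-form on 19606's binders: `stub_etaMC_cm` modulo the two named facts and the `μ`-part -/

/-- **19606's CM stub reduced to ONE `μ`-statement (text of the registered `Sig.stub_etaMC_cm`).**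
Granted `h26` (BT26 Thm. 2.6 ∘ Kob03), `h22` (Kob03 Thm. 2.2 at `η`) and the `μ`-EQUALITY
`μ(X⁺(V/K_∞)^η) = μ(Λ/(L_p⁺(V, η, X)))` on the CM Gss2 rows (displayed, OPEN — BT26 Rem. 2.7): for
every `p ≥ 5` and every good `a_p = 0` CM twist `V` (the `¬ onto` binder idle),
`QuadraticBranchPlusEtaMainConjectureAt V p`. CONDITIONAL; the stub is NOT proved by name.
[cite: BurungaleTian2026, Thm. 2.6 and Rem. 2.7 (p. 5)] [cite: Kobayashi2003, §4 Even main conjecture (p. 8), Thm. 2.2 (p. 5)]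
[cite: PollackRubin2004, Theorem and remark p. 448] -/
theorem etaMC_cm_of_bt26_of_muInvariant_eq
    (h26 : BurungaleTian2026.thm26_etaKatoSequences_charIdeal_upToP_of_cm)
    (h22 : Kobayashi2003.thm22_etaSignedSelmerDual_finite_torsion)
    (hμ : ∀ (V : WeierstrassCurve ℚ) [V.IsElliptic] [V.IsGloballyMinimal] (p : ℕ) [Fact p.Prime],
      5 ≤ p → V.HasGoodReductionAtPrime p → V.frobeniusTrace p = 0 → V.HasCM →
      ∀ (K₀ : Type) [Field K₀] [NumberField K₀] [IsCyclotomicExtension {p} ℚ K₀]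
          [(galRange (K := ℚ) K₀).Normal] (ηq : absoluteGaloisGroup ℚ →* ℤˣ),
          (∀ σ ∈ galRange (K := ℚ) K₀, ηq σ = 1) → ηq ≠ 1 →
        ∀ {N : ℕ} [NeZero N] {f : CuspForm (Gamma0 N) 2},
          p ≠ 2 → V.HasGoodReductionAtPrime p → V.frobeniusTrace p = 0 → IsNewformOf V f →
        ∀ (ϖ : ℚ), (if Even (p / 2) then (ϖ : ℝ) * V.realPeriodRat = plusPeriod f
            else (ϖ : ℝ) * V.imaginaryPeriodRat = minusPeriod f) →
        ∀ (Lη : IwasawaAlgebra p), IsQuadraticBranchPlusLFunction f p ϖ Lη →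
        ∀ (κ : ZpExtension ℚ p) (γ : absoluteGaloisGroup ℚ),
          κ.IsCyclotomic → κ.IsTopGenerator γ → γ ∈ galRange (K := ℚ) K₀ → IsCyclotomicVariable p γ →
        ∀ (D : EtaSignedSelmerDualData V κ K₀ ℚ_[p] ηq γ 1),
          muInvariant p D.X = muInvariant p (IwasawaAlgebra p ⧸ Ideal.span {Lη})) :
    ∀ (V : WeierstrassCurve ℚ) [V.IsElliptic] [V.IsGloballyMinimal] (p : ℕ) [Fact p.Prime],
      5 ≤ p → V.HasGoodReductionAtPrime p → V.frobeniusTrace p = 0 →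
      ¬ (∀ m : ℕ, V.HasSurjectiveModNGaloisRep (p ^ m : ℕ)) → V.HasCM →
        QuadraticBranchPlusEtaMainConjectureAt V p := by
  intro V _ _ p _ hp5 hgood hap _ hCM
  exact (quadraticBranchPlusEtaMainConjectureAt_iff_muInvariant_eq_of_cm h26 h22 hCM).mpr
    (hμ V p hp5 hgood hap hCM)

end EtaCMUpToMu
end Summit.BirchSwinnertonDyer.BirchSwinnertonDyer.Theorems

end
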